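import Summits.ResolutionOfSingularities.ResolutionOfSingularities.Theorems.EquisingularLiftEquisingularLiftNatEquinodalHyperplaneAlg
import Literature.AlgebraicGeometry.PlaneCurves.PolarConicHessian
import HarnessLib

/-!
# [OURS · L1 W4.5(b) · EL♮(3) · door ν4, brick N-0 (JINIT at `RD := RPlus`), pieces (N0-a)/(N0-b)] THE HYPERPLANE DATA OF `EqCertAt₀`, NORMALISED
# AND LIFTED OVER `O` — ★ `HyperplaneLift.exists_hyperplane_lift`

res-L1-w45b-nose-w1 g4 (WIDTH seat D-0157 DOOR 1).  Pure `MvPolynomial` algebra (no scheme); DEF-FREE; no `sorry`; standard axioms.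
`--supports stmt-ResolutionOfSingularities-20148 --as helper`, counted 0.

WHAT.  The certificate `EqCertAt₀ k n ℓ Z hZ` (…NatResidueHypDefsE) carries hyperplane coordinates `B : Fin (n+1) → Fin n → k` with an invertible
row-minor on `r : Fin n ↪ Fin (n+1)`.  For the rung's upstairs stage `ℙⁿ_O` (`θ : O ↠ k` the residue map of a local domain) brick N-0 needs this
data OVER `O`, compatibly:

* ★ `exists_hyperplane_lift` — a missed index `a₀ ∉ range r`, a lift `B̃` of `B` (`θ ∘ B̃ = B`) whose `r`-minor is a UNIT, the LINEAR FORM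
  `L̃ = Σ_a c̃_a x_a` with `c̃_{a₀} = 1` and `L̃ ∘ B̃ = 0` generating `ker (x ↦ B̃·y)` (`L̃ ∣ f` whenever `f(B̃ y) = 0`), a homogeneous SECTION
  `y_i ↦ Σ_j Ñ_{ij} x_{r j}` of the substitution (so every form `G̃(y)` on the hyperplane is `Ĝ(B̃ y)` for the form `Ĝ := G̃(Ñ x_r)` on `ℙⁿ_O`),
  and DOWNSTAIRS the reduction `θ L̃ = Σ_a θ(c̃_a) x_a` generating `ker (x ↦ B·y)` — in particular `θ L̃ ∣ ℓ` for the door's `ℓ`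
  (`restrictToHyperplane B ℓ = 0` is literally `aeval (x ↦ B·y) ℓ = 0`).  Over `O` the kernel generator is ✓ `HyperplaneAlg.exists_hyperplane_section`
  (res-L1-w45b-nose-w1 g3); the new content is the COMPATIBLE LIFT (`B̃_{a₀ j} := −Σ_i c̃_{r i} B̃_{r i, j}` corrects the naive lift so that
  `L̃ ∘ B̃ = 0` holds exactly) and the uniqueness of a normalised linear generator (`eq_zero_of_dvd_of_isHomogeneous_one`).
* The coefficient vector `c̃` with unit `c̃_{a₀}` is EXACTLY the input of res-type-027's ✓ `LinearLetter.exists_hyperplane_model` /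
  ✓ `TCPlus.letterDatum_hyperplane` (host letter model `V₊(L̃) ⊂ ℙⁿ_O`), which the N-0 assembly calls next.

EL♮(3) is NOT proved here; resolution of singularities in positive characteristic is NOT proved here.
-/

set_option linter.dupNamespace false -- mandated namespace `Summit.<Summit>.<Problem>` of this single-conjunct summit

noncomputable section

open MvPolynomial

namespace Summit.ResolutionOfSingularities.ResolutionOfSingularities.Cruxes.EquisingularLiftNat.Sections.Equinodal.HyperplaneLift

variable {R : Type*} [CommRing R] {n : ℕ}

/-! ## §1 Small algebra: coefficients of linear forms, uniqueness of a normalised linear generator -/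

/-- the `x_b`-coefficient of `Σ_a c_a x_a` is `c_b`. [folklore] -/
theorem coeff_single_sum_C_mul_X {σ : Type*} [Fintype σ] [DecidableEq σ] (c : σ → R) (b : σ) :
    coeff (Finsupp.single b 1) (∑ a, C (c a) * X a : MvPolynomial σ R) = c b := by
  rw [coeff_sum, Finset.sum_eq_single b]
  · rw [coeff_C_mul, coeff_X, if_pos rfl, mul_one]
  · intro a _ hab
    rw [coeff_C_mul, coeff_X, if_neg, mul_zero]
    exact fun h => hab (Finsupp.single_left_injective one_ne_zero h)
  · intro h; exact absurd (Finset.mem_univ b) h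

/-- the `y_j`-coefficient of the substituted linear form `(Σ_a c_a x_a)(B·y) = Σ_j (Σ_a c_a B_{aj}) y_j`. [folklore] -/
theorem aeval_linear_sum_C_mul_X {m : ℕ} (B : Fin (n + 1) → Fin m → R) (c : Fin (n + 1) → R) :
    aeval (fun a : Fin (n + 1) => ∑ j : Fin m, C (B a j) * X j) (∑ a, C (c a) * X a : MvPolynomial (Fin (n + 1)) R) =
      ∑ j : Fin m, C (∑ a, c a * B a j) * X j := by
  rw [HyperplaneAlg.aeval_sum_C_mul_X]
  simp_rw [Finset.mul_sum, ← mul_assoc, ← C_mul]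
  rw [Finset.sum_comm]
  simp_rw [← Finset.sum_mul, ← map_sum]

/-- reduction of a linear form with given coefficients. [folklore] -/
theorem map_sum_C_mul_X {S : Type*} [CommRing S] (θ : R →+* S) {σ : Type*} [Fintype σ] (c : σ → R) :
    MvPolynomial.map θ (∑ a, C (c a) * X a : MvPolynomial σ R) = ∑ a, C (θ (c a)) * X a := by
  rw [map_sum]
  exact Finset.sum_congr rfl fun a _ => by rw [map_mul, map_C, map_X]

/-- **Uniqueness of a normalised linear generator** (domain): a homogeneous linear `g` with `x_{a₀}`-coefficient `0` divisible by a homogeneous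
linear `L` with `x_{a₀}`-coefficient `≠ 0` is `0`. [folklore] -/
theorem eq_zero_of_dvd_of_isHomogeneous_one [IsDomain R] {σ : Type*} {L g : MvPolynomial σ R} {a₀ : σ} (hL : L.IsHomogeneous 1)
    (hLa : coeff (Finsupp.single a₀ 1) L ≠ 0) (hg : g.IsHomogeneous 1) (hga : coeff (Finsupp.single a₀ 1) g = 0) (hdvd : L ∣ g) :
    g = 0 := by
  classical
  obtain ⟨q, rfl⟩ := hdvd
  by_contra hne
  have hL0 : L ≠ 0 := fun h => by simp [h] at hne
  have hq0 : q ≠ 0 := fun h => by simp [h] at hne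
  have hdeg := totalDegree_mul_of_isDomain hL0 hq0
  rw [hg.totalDegree hne, hL.totalDegree hL0] at hdeg
  have hq : q.totalDegree = 0 := by omega
  obtain ⟨c, hc⟩ : ∃ c : R, q = C c := ⟨coeff 0 q, totalDegree_eq_zero_iff_eq_C.mp hq⟩
  rw [hc, mul_comm, coeff_C_mul] at hga
  rcases mul_eq_zero.mp hga with h | h
  · exact hq0 (by rw [hc, h, C_0])
  · exact hLa h

/-- an injective `r : Fin n → Fin (n+1)` misses some index. [folklore] -/
theorem exists_not_mem_range (r : Fin n → Fin (n + 1)) (hr : Function.Injective r) : ∃ a₀, ∀ j, r j ≠ a₀ := by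
  by_contra h
  simp only [not_exists, not_forall, not_not] at h
  have hsurj : Function.Surjective r := fun a => h a
  have := Fintype.card_of_bijective ⟨hr, hsurj⟩
  simp at this

/-- reduction commutes with a linear substitution whose matrix reduces accordingly: `θ (F(B̃ y)) = (θ F)(B y)` when `θ ∘ B̃ = B`. [folklore] -/
theorem map_aeval_linear {S : Type*} [CommRing S] (θ : R →+* S) {m : ℕ} (Bt : Fin (n + 1) → Fin m → R) (B : Fin (n + 1) → Fin m → S)
    (hB : ∀ a j, θ (Bt a j) = B a j) (F : MvPolynomial (Fin (n + 1)) R) :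
    MvPolynomial.map θ (aeval (fun a : Fin (n + 1) => ∑ j : Fin m, C (Bt a j) * X j) F) =
      aeval (fun a : Fin (n + 1) => ∑ j : Fin m, C (B a j) * X j) (MvPolynomial.map θ F) := by
  induction F using MvPolynomial.induction_on with
  | C a => simp
  | add p q hp hq => simp only [map_add, hp, hq]
  | mul_X p a hp =>
    rw [map_mul, map_mul, hp, aeval_X, map_mul, map_X, map_mul, aeval_X, map_sum]
    congr 1
    exact Finset.sum_congr rfl fun j _ => by rw [map_mul, map_C, map_X, hB]

/-! ## §2 The lift -/

/-- ★ **THE HYPERPLANE DATA, NORMALISED AND LIFTED OVER `O`.**  `θ : O ↠ k` a surjection from a local domain onto a field detecting units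
(`θ x ≠ 0 ⇒ IsUnit x`); `B : Fin (n+1) → Fin n → k` with invertible row-minor on the injective `r`.  THEN there are `a₀ ∉ range r`, a lift `B̃`
(`θ ∘ B̃ = B`) with UNIT `r`-minor, coefficients `c̃` with `c̃_{a₀} = 1`, and a matrix `Ñ` such that, with `L̃ := Σ_a c̃_a x_a` and the substitutions
`ψ̃ := (x_a ↦ Σ_j B̃_{aj} y_j)`, `σ̃ := (y_i ↦ Σ_j Ñ_{ij} x_{r j})`: `ψ̃ L̃ = 0`, `ψ̃ ∘ σ̃ = id`, `ψ̃ f = 0 ⇒ L̃ ∣ f`; and downstairs, with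
`ψ := (x_a ↦ Σ_j B_{aj} y_j)` (= `restrictToHyperplane B`): `ψ (θ L̃) = 0` and `ψ f = 0 ⇒ θ L̃ ∣ f`, where `θ L̃ = Σ_a θ(c̃_a) x_a`.
[OURS · brick N-0 pieces (N0-a)/(N0-b); folklore linear algebra] -/
theorem exists_hyperplane_lift {O k : Type*} [CommRing O] [IsDomain O] [Field k] (θ : O →+* k) (hθ : Function.Surjective θ)
    (hunit : ∀ x : O, θ x ≠ 0 → IsUnit x) (B : Fin (n + 1) → Fin n → k) (r : Fin n → Fin (n + 1)) (hr : Function.Injective r)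
    (hdet : (Matrix.of fun j j' : Fin n => B (r j) j').det ≠ 0) :
    ∃ (a₀ : Fin (n + 1)) (Bt : Fin (n + 1) → Fin n → O) (ct : Fin (n + 1) → O) (Nt : Fin n → Fin n → O),
      (∀ j, r j ≠ a₀) ∧ (∀ a j, θ (Bt a j) = B a j) ∧ IsUnit (Matrix.of fun j j' : Fin n => Bt (r j) j').det ∧ ct a₀ = 1 ∧
      aeval (fun a : Fin (n + 1) => ∑ j : Fin n, C (Bt a j) * X j) (∑ a, C (ct a) * X a : MvPolynomial (Fin (n + 1)) O) = 0 ∧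
      (∀ G : MvPolynomial (Fin n) O,
        aeval (fun a : Fin (n + 1) => ∑ j : Fin n, C (Bt a j) * X j) (aeval (fun i : Fin n => ∑ j : Fin n, C (Nt i j) * X (r j)) G) = G) ∧
      (∀ f : MvPolynomial (Fin (n + 1)) O,
        aeval (fun a : Fin (n + 1) => ∑ j : Fin n, C (Bt a j) * X j) f = 0 → (∑ a, C (ct a) * X a : MvPolynomial (Fin (n + 1)) O) ∣ f) ∧
      aeval (fun a : Fin (n + 1) => ∑ j : Fin n, C (B a j) * X j) (∑ a, C (θ (ct a)) * X a : MvPolynomial (Fin (n + 1)) k) = 0 ∧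
      (∀ f : MvPolynomial (Fin (n + 1)) k,
        aeval (fun a : Fin (n + 1) => ∑ j : Fin n, C (B a j) * X j) f = 0 → (∑ a, C (θ (ct a)) * X a : MvPolynomial (Fin (n + 1)) k) ∣ f) := by
  classical
  obtain ⟨a₀, ha₀⟩ := exists_not_mem_range r hr
  -- downstairs: the normalised kernel generator `L` of `ψ`
  obtain ⟨L, N, hL1, hLa, hψL, -, hkerL⟩ := HyperplaneAlg.exists_hyperplane_section B r a₀ hr ha₀ (Ne.isUnit hdet)
  -- its coefficient vector
  set ck : Fin (n + 1) → k := fun a => coeff 0 (pderiv a L) with hck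
  have hLsum : L = ∑ a, C (ck a) * X a := Literature.AlgebraicGeometry.PlaneCurves.eq_sum_C_mul_X_of_isHomogeneous_one hL1
  have hcka₀ : ck a₀ = 1 := by
    have h := coeff_single_sum_C_mul_X ck a₀
    rwa [← hLsum, hLa, eq_comm] at h
  -- the coefficient relations `Σ_a ck_a B_{aj} = 0`
  have hrel : ∀ j : Fin n, ∑ a, ck a * B a j = 0 := by
    intro j
    have h := hψL
    rw [hLsum, aeval_linear_sum_C_mul_X] at h
    have h' := congrArg (coeff (Finsupp.single j 1)) h
    rwa [coeff_single_sum_C_mul_X, coeff_zero] at h'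
  -- a set-theoretic section of `θ`, the lifted coefficients, the corrected lift of `B`
  let s : k → O := Function.surjInv hθ
  have hs : ∀ x, θ (s x) = x := Function.surjInv_eq hθ
  let ct : Fin (n + 1) → O := fun a => if a = a₀ then 1 else s (ck a)
  have hct : ∀ a, θ (ct a) = ck a := by
    intro a; by_cases h : a = a₀
    · subst h; simp [ct, hcka₀]
    · simp [ct, h, hs]
  let d : Fin n → O := fun j => ∑ a, ct a * s (B a j)
  have hd : ∀ j, θ (d j) = 0 := by
    intro j
    simp only [d, map_sum, map_mul, hct, hs]
    exact hrel j
  let Bt : Fin (n + 1) → Fin n → O := fun a j => s (B a j) - if a = a₀ then d j else 0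
  have hBt : ∀ a j, θ (Bt a j) = B a j := by
    intro a j; by_cases h : a = a₀
    · subst h; simp [Bt, hs, hd]
    · simp [Bt, h, hs]
  have hBtr : ∀ j j', Bt (r j) j' = s (B (r j) j') := fun j j' => by simp [Bt, ha₀ j]
  -- `L̃ ∘ B̃ = 0` exactly
  have hrelt : ∀ j : Fin n, ∑ a, ct a * Bt a j = 0 := by
    intro j
    have hsplit : ∑ a, ct a * Bt a j = ∑ a, ct a * s (B a j) - ∑ a, ct a * (if a = a₀ then d j else 0) := by
      rw [← Finset.sum_sub_distrib]
      exact Finset.sum_congr rfl fun a _ => by simp only [Bt, mul_sub]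
    have hite : ∑ a, ct a * (if a = a₀ then d j else 0) = ct a₀ * d j := by
      rw [Finset.sum_eq_single a₀]
      · rw [if_pos rfl]
      · intro a _ ha; rw [if_neg ha, mul_zero]
      · intro h; exact absurd (Finset.mem_univ a₀) h
    rw [hsplit, hite]
    simp [ct, d]
  have hψt : aeval (fun a : Fin (n + 1) => ∑ j : Fin n, C (Bt a j) * X j) (∑ a, C (ct a) * X a : MvPolynomial (Fin (n + 1)) O) = 0 := by
    rw [aeval_linear_sum_C_mul_X]
    exact Finset.sum_eq_zero fun j _ => by rw [hrelt j, C_0, zero_mul]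
  -- the minor of `B̃` is a unit (its reduction is `det ≠ 0`)
  have hdett : IsUnit (Matrix.of fun j j' : Fin n => Bt (r j) j').det := by
    refine hunit _ fun h => hdet ?_
    rw [RingHom.map_det] at h
    convert h using 2
    ext j j'
    simp [Matrix.of_apply, hBtr, hs]
  -- upstairs: the kernel generator `L'` of `ψ̃` IS `L̃ = Σ c̃_a x_a`
  obtain ⟨L', Nt, hL'1, hL'a, hψL', hsec', hkerL'⟩ := HyperplaneAlg.exists_hyperplane_section Bt r a₀ hr ha₀ hdett
  have hcta₀ : ct a₀ = 1 := by simp [ct]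
  have hLt1 : (∑ a, C (ct a) * X a : MvPolynomial (Fin (n + 1)) O).IsHomogeneous 1 := HyperplaneAlg.isHomogeneous_sum_C_mul_X ct id
  have hLtL' : (∑ a, C (ct a) * X a : MvPolynomial (Fin (n + 1)) O) = L' := by
    have hdvd : L' ∣ (∑ a, C (ct a) * X a : MvPolynomial (Fin (n + 1)) O) - L' := by
      refine hkerL' _ ?_
      rw [map_sub, hψt, hψL', sub_zero]
    have h0 := eq_zero_of_dvd_of_isHomogeneous_one hL'1 (by rw [hL'a]; exact one_ne_zero) (hLt1.sub hL'1)
      (by rw [coeff_sub, coeff_single_sum_C_mul_X, hcta₀, hL'a, sub_self]) hdvd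
    exact sub_eq_zero.mp h0
  -- downstairs: `θ L̃ = L`
  have hθLt : (∑ a, C (θ (ct a)) * X a : MvPolynomial (Fin (n + 1)) k) = L := by
    rw [hLsum]; exact Finset.sum_congr rfl fun a _ => by rw [hct]
  refine ⟨a₀, Bt, ct, Nt, ha₀, hBt, hdett, hcta₀, hψt, ?_, ?_, ?_, ?_⟩
  · intro G; exact hsec' G
  · intro f hf; rw [hLtL']; exact hkerL' f hf
  · rw [hθLt]; exact hψL
  · intro f hf; rw [hθLt]; exact hkerL f hf

end Summit.ResolutionOfSingularities.ResolutionOfSingularities.Cruxes.EquisingularLiftNat.Sections.Equinodal.HyperplaneLift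

end
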